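import Summits.MatrixMultiplication.MatrixMultiplication.Theorems.ObstructionDescentUniversalOccurrenceTwoRectangleThreeThreeOneTableaux
import Summits.MatrixMultiplication.MatrixMultiplication.Theorems.ObstructionDescentUniversalOccurrenceTwoRectangleTwistSign

set_option linter.dupNamespace false
set_option autoImplicit false

/-!
# Universal occurrence — two rectangles and the shape `(2N-7,3,3,1)`, part C₁: lifts of a supported term (decomp-mm · lens 3 · gen 46)

Route `route-MatrixMultiplication-ObstructionDescent` (sub-problem `MatrixMultiplication`, `ω(ℂ) = 2`); SUPPORT for the crux
`NoOccurrenceObstruction` (`P_O`, item `stmt-MatrixMultiplication-29040`) through the universal-occurrence programme (NODE-g29…g46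
of the decomp-mm cell, lens 3).  Nothing here proves `ω = 2` or closes an item; no `def`, no `sorry`, standard axioms.

**Setting.**  The design `D″(N)` of part C (`…ThreeThreeOne`) for the triple `((2^N),(2^N),(2N-7,3,3,1))`, `m = N+2`: positions
`q < 2N` sit in block `q % 2`, slot `q / 2` of `e`; the lifts `φ, ψ : [N+2] → [N]` extend the identity by `φ(N) = 0, φ(N+1) = 1`,
`ψ(N) = 1, ψ(N+1) = 0`; the third leg `γ` sends `1, 3 ↦ 1`, `2, N+1 ↦ 2`, `N ↦ 3` and everything else to `0`, and is fed to the
polytabloid `e_T` of the tableau `T″` of part A.  A term of the storey sum is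
`ζ_e(φ∘ι) · ζ_e((ψ∘ι)∘κ) · e_T(γ∘ι)` (`κ` the double cross at slots `0, 3`).

**Contents.**  §0: two elementary helpers (a pigeonhole for four elements of a three-element set; the final sign bookkeeping).
§1: the three column readings `π₀ ∈ S_4`, `π₁, π₂ ∈ S_3` of a word supported by `e_T` and the value
`e_T = sgn π₀ · sgn π₁ · sgn π₂` (`threeThreeOne_perms_of_support`, `threeThreeOne_columns`).  §2: **well-formedness** — if the
first-leg block sign and the tableau factor of `ι` do not vanish, the letters `N` and `N+1` occur in `ι` exactly once each
(`threeThreeOne_lift_wf`: `N` is the letter-`3` cell of column `0`; the three letter-`2` cells carry `ι ∈ {2, N+1}` and, the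
first-leg word being a bijection on each of the two blocks, exactly two of them carry `ι = 2`).  §3: the **toggle identity**
`ζ_e(φ∘ι) · ζ_e((ψ∘ι)∘κ) = ζ_e((φ∘ι)∘κ) · ζ_e(ψ∘ι)` for well-formed `ι` whose two special cells lie in one block of `e` AND in
one block of the twisted structure (`threeThreeOne_toggle_symm`) — the engine of the cancelling involution of part C.

[cite: BurgisserIkenmeyer2011, Thm. 4.4, Lemma 6.1] [cite: BurgisserIkenmeyer2017, §5, Thm. 5.9 (proof of (2)), eq. (3.4)]
-/

noncomputable section

open scoped BigOperators

namespace Summit.MatrixMultiplication.MatrixMultiplication.Theorems.ObstructionCalculus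

open Literature.Computability.AlgebraicComplexity
open Literature.NumberTheory.DiophantineGeometry

/-! ### §0 Helpers -/

/-- Four pairwise distinct elements do not fit into a three-element set. [folklore] -/
theorem four_mem_three {α : Type*} {C₀ C₁ C₂ a b c d : α} (ha : a = C₀ ∨ a = C₁ ∨ a = C₂) (hb : b = C₀ ∨ b = C₁ ∨ b = C₂)
    (hc : c = C₀ ∨ c = C₁ ∨ c = C₂) (hd : d = C₀ ∨ d = C₁ ∨ d = C₂) (hab : a ≠ b) (hac : a ≠ c) (had : a ≠ d)
    (hbc : b ≠ c) (hbd : b ≠ d) (hcd : c ≠ d) : False := by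
  rcases ha with rfl | rfl | rfl <;> rcases hb with rfl | rfl | rfl <;> (try exact hab rfl) <;>
    rcases hc with rfl | rfl | rfl <;> (try exact hac rfl) <;> (try exact hbc rfl) <;>
    rcases hd with rfl | rfl | rfl <;> first | exact had rfl | exact hbd rfl | exact hcd rfl

/-- Sign bookkeeping: `±1 · (-1)^a (-1)^b (-1)^c = -1` when `a + b + c` is odd exactly in the `+1` case. [folklore] -/
theorem sign_combine (a b c : ℕ) (S : Prop) [Decidable S] (hodd : S → (a + b + c) % 2 = 1)
    (heven : ¬ S → (a + b + c) % 2 = 0) :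
    (if S then (1 : ℂ) else -1) *
      ((if a % 2 = 0 then (1 : ℂ) else -1) * (if b % 2 = 0 then (1 : ℂ) else -1) * (if c % 2 = 0 then (1 : ℂ) else -1)) =
      -1 := by
  by_cases hs : S
  · have h := hodd hs
    rw [if_pos hs]
    split_ifs <;> norm_num <;> omega
  · have h := heven hs
    rw [if_neg hs]
    split_ifs <;> norm_num <;> omega

/-! ### §1 Column readings of a supported third-leg word -/

/-- **Column readings.**  A word vanishing on the arm and reading letters `< 4` injectively down column `0` and letters `< 3`
injectively down columns `1, 2` reads three permutations `π₀, π₁, π₂`, and `e_T = sgn π₀ · sgn π₁ · sgn π₂`. [folklore] -/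
theorem threeThreeOne_perms_of_support {N : ℕ} {Y : YoungDiagram} (hNY : ∀ x ∈ Y.cells, x.1 < N) (T : StdFilling (N * 2) Y)
    (hT : ∀ p : Fin (N * 2), T.1 p = (if (p : ℕ) < 4 then ((p : ℕ), 0)
      else if (p : ℕ) < 10 then (((p : ℕ) - 4) % 3, ((p : ℕ) - 4) / 3 + 1) else (0, (p : ℕ) - 7)))
    (h10 : 10 ≤ N * 2) {w : Word N (N * 2)} (harm : ∀ p : Fin (N * 2), 10 ≤ (p : ℕ) → ((w p : Fin N) : ℕ) = 0)
    (hlt0 : ∀ p : Fin (N * 2), (p : ℕ) < 4 → ((w p : Fin N) : ℕ) < 4)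
    (hlt12 : ∀ p : Fin (N * 2), 4 ≤ (p : ℕ) → (p : ℕ) < 10 → ((w p : Fin N) : ℕ) < 3)
    (hinj0 : ∀ p q : Fin (N * 2), (p : ℕ) < 4 → (q : ℕ) < 4 → w p = w q → p = q)
    (hinj1 : ∀ p q : Fin (N * 2), 4 ≤ (p : ℕ) → (p : ℕ) < 7 → 4 ≤ (q : ℕ) → (q : ℕ) < 7 → w p = w q → p = q)
    (hinj2 : ∀ p q : Fin (N * 2), 7 ≤ (p : ℕ) → (p : ℕ) < 10 → 7 ≤ (q : ℕ) → (q : ℕ) < 10 → w p = w q → p = q) :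
    ∃ π₀ : Equiv.Perm (Fin 4), ∃ π₁ π₂ : Equiv.Perm (Fin 3),
      (∀ i : Fin 4, ((π₀ i : Fin 4) : ℕ) = ((w ⟨i, by omega⟩ : Fin N) : ℕ)) ∧
      (∀ i : Fin 3, ((π₁ i : Fin 3) : ℕ) = ((w ⟨(i : ℕ) + 4, by omega⟩ : Fin N) : ℕ)) ∧
      (∀ i : Fin 3, ((π₂ i : Fin 3) : ℕ) = ((w ⟨(i : ℕ) + 7, by omega⟩ : Fin N) : ℕ)) ∧
      T.polytabloid ℂ hNY w =
        ((Equiv.Perm.sign π₀ : ℤ) : ℂ) * ((Equiv.Perm.sign π₁ : ℤ) : ℂ) * ((Equiv.Perm.sign π₂ : ℤ) : ℂ) := by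
  classical
  let g₀ : Fin 4 → Fin 4 := fun i => ⟨((w ⟨i, by omega⟩ : Fin N) : ℕ), hlt0 _ (by simp)⟩
  have hg₀ : Function.Injective g₀ := by
    intro i j hij
    have h1 : (w ⟨i, by omega⟩ : Fin N) = w ⟨j, by omega⟩ := Fin.ext (by simpa [g₀] using congrArg Fin.val hij)
    have h2 := hinj0 ⟨i, by omega⟩ ⟨j, by omega⟩ (by dsimp only; omega) (by dsimp only; omega) h1
    exact Fin.ext (by simpa using congrArg Fin.val h2)
  let g₁ : Fin 3 → Fin 3 := fun i =>
    ⟨((w ⟨(i : ℕ) + 4, by omega⟩ : Fin N) : ℕ), hlt12 _ (by dsimp only; omega) (by dsimp only; omega)⟩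
  have hg₁ : Function.Injective g₁ := by
    intro i j hij
    have h1 : (w ⟨(i : ℕ) + 4, by omega⟩ : Fin N) = w ⟨(j : ℕ) + 4, by omega⟩ :=
      Fin.ext (by simpa [g₁] using congrArg Fin.val hij)
    have h2 := hinj1 ⟨(i : ℕ) + 4, by omega⟩ ⟨(j : ℕ) + 4, by omega⟩ (by dsimp only; omega)
      (by dsimp only; omega) (by dsimp only; omega) (by dsimp only; omega) h1
    exact Fin.ext (by simpa using congrArg Fin.val h2)
  let g₂ : Fin 3 → Fin 3 := fun i =>
    ⟨((w ⟨(i : ℕ) + 7, by omega⟩ : Fin N) : ℕ), hlt12 _ (by dsimp only; omega) (by dsimp only; omega)⟩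
  have hg₂ : Function.Injective g₂ := by
    intro i j hij
    have h1 : (w ⟨(i : ℕ) + 7, by omega⟩ : Fin N) = w ⟨(j : ℕ) + 7, by omega⟩ :=
      Fin.ext (by simpa [g₂] using congrArg Fin.val hij)
    have h2 := hinj2 ⟨(i : ℕ) + 7, by omega⟩ ⟨(j : ℕ) + 7, by omega⟩ (by dsimp only; omega)
      (by dsimp only; omega) (by dsimp only; omega) (by dsimp only; omega) h1
    exact Fin.ext (by simpa using congrArg Fin.val h2)
  let π₀ : Equiv.Perm (Fin 4) := Equiv.ofBijective g₀ (Finite.injective_iff_bijective.1 hg₀)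
  let π₁ : Equiv.Perm (Fin 3) := Equiv.ofBijective g₁ (Finite.injective_iff_bijective.1 hg₁)
  let π₂ : Equiv.Perm (Fin 3) := Equiv.ofBijective g₂ (Finite.injective_iff_bijective.1 hg₂)
  exact ⟨π₀, π₁, π₂, fun i => rfl, fun i => rfl, fun i => rfl,
    threeThreeOneTableau_apply_eq_sign hNY T hT h10 harm π₀ (fun i => rfl) π₁ (fun i => rfl) π₂ (fun i => rfl)⟩

/-- **Column readings of a supported word.**  If `e_T(w) ≠ 0`, the three columns read permutations `π₀, π₁, π₂`, the arm reads
`0`, and `e_T(w) = sgn π₀ · sgn π₁ · sgn π₂`. [folklore] -/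
theorem threeThreeOne_columns {N : ℕ} {Y : YoungDiagram} (hNY : ∀ x ∈ Y.cells, x.1 < N) (T : StdFilling (N * 2) Y)
    (hT : ∀ p : Fin (N * 2), T.1 p = (if (p : ℕ) < 4 then ((p : ℕ), 0)
      else if (p : ℕ) < 10 then (((p : ℕ) - 4) % 3, ((p : ℕ) - 4) / 3 + 1) else (0, (p : ℕ) - 7)))
    (h10 : 10 ≤ N * 2) {w : Word N (N * 2)} (hw : T.polytabloid ℂ hNY w ≠ 0) :
    ∃ π₀ : Equiv.Perm (Fin 4), ∃ π₁ π₂ : Equiv.Perm (Fin 3),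
      (∀ i : Fin 4, ((π₀ i : Fin 4) : ℕ) = ((w ⟨i, by omega⟩ : Fin N) : ℕ)) ∧
      (∀ i : Fin 3, ((π₁ i : Fin 3) : ℕ) = ((w ⟨(i : ℕ) + 4, by omega⟩ : Fin N) : ℕ)) ∧
      (∀ i : Fin 3, ((π₂ i : Fin 3) : ℕ) = ((w ⟨(i : ℕ) + 7, by omega⟩ : Fin N) : ℕ)) ∧
      (∀ p : Fin (N * 2), 10 ≤ (p : ℕ) → ((w p : Fin N) : ℕ) = 0) ∧
      T.polytabloid ℂ hNY w =
        ((Equiv.Perm.sign π₀ : ℤ) : ℂ) * ((Equiv.Perm.sign π₁ : ℤ) : ℂ) * ((Equiv.Perm.sign π₂ : ℤ) : ℂ) := by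
  obtain ⟨harm, hlt0, hlt12, hinj0, hinj1, hinj2⟩ := threeThreeOneTableau_support hNY T hT hw
  obtain ⟨π₀, π₁, π₂, h0, h1, h2, hval⟩ :=
    threeThreeOne_perms_of_support hNY T hT h10 harm hlt0 hlt12 hinj0 hinj1 hinj2
  exact ⟨π₀, π₁, π₂, h0, h1, h2, harm, hval⟩

/-! ### §2 Well-formedness: `N` and `N+1` occur exactly once -/

/-- **Well-formedness of a supported lift.**  If the first-leg block sign `ζ_e(φ∘ι)` and the tableau factor `e_T(γ∘ι)` are
non-zero, then `ι` takes the value `N` at exactly one position (the letter-`3` cell of column `0`) and the value `N+1` at exactly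
one position (one of the three letter-`2` cells: these carry `ι ∈ {2, N+1}`, the first-leg word is a bijection on both blocks and
`φ∘ι = 2` exactly where `ι = 2`, so exactly two of them carry `ι = 2`). [this node] -/
theorem threeThreeOne_lift_wf {N : ℕ} (hN : 5 ≤ N) {Y : YoungDiagram} (hNY : ∀ x ∈ Y.cells, x.1 < N)
    (T : StdFilling (N * 2) Y)
    (hT : ∀ p : Fin (N * 2), T.1 p = (if (p : ℕ) < 4 then ((p : ℕ), 0)
      else if (p : ℕ) < 10 then (((p : ℕ) - 4) % 3, ((p : ℕ) - 4) / 3 + 1) else (0, (p : ℕ) - 7)))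
    (e : Fin (N * 2) ≃ Fin 2 × Fin N) {φ γ : Fin (N + 2) → Fin N}
    (hφv : ∀ r, ((φ r : Fin N) : ℕ) = if (r : ℕ) < N then (r : ℕ) else (r : ℕ) - N)
    (hγv : ∀ r, ((γ r : Fin N) : ℕ) = if (r : ℕ) = 1 then 1 else if (r : ℕ) = 2 then 2 else if (r : ℕ) = 3 then 1
      else if (r : ℕ) = N then 3 else if (r : ℕ) = N + 1 then 2 else 0)
    (ι : Fin (N * 2) → Fin (N + 2)) (hx : wordBlockSign ℂ e (φ ∘ ι) ≠ 0) (hw : T.polytabloid ℂ hNY (γ ∘ ι) ≠ 0) :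
    ∃ pN pM : Fin (N * 2), ((ι pN : Fin (N + 2)) : ℕ) = N ∧ (∀ q, ((ι q : Fin (N + 2)) : ℕ) = N → q = pN) ∧
      ((ι pM : Fin (N + 2)) : ℕ) = N + 1 ∧ (∀ q, ((ι q : Fin (N + 2)) : ℕ) = N + 1 → q = pM) := by
  classical
  obtain ⟨harm, hlt0, hlt12, hinj0, hinj1, hinj2⟩ := threeThreeOneTableau_support hNY T hT hw
  obtain ⟨π₀, π₁, π₂, hπ₀, hπ₁, hπ₂, -, -⟩ := threeThreeOne_columns hNY T hT (by omega) hw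
  have hwv : ∀ q, (((γ ∘ ι) q : Fin N) : ℕ) = if ((ι q : Fin (N + 2)) : ℕ) = 1 then 1 else if ((ι q : Fin (N + 2)) : ℕ) = 2
      then 2 else if ((ι q : Fin (N + 2)) : ℕ) = 3 then 1 else if ((ι q : Fin (N + 2)) : ℕ) = N then 3
      else if ((ι q : Fin (N + 2)) : ℕ) = N + 1 then 2 else 0 := fun q => hγv (ι q)
  have hw3 : ∀ q, (((γ ∘ ι) q : Fin N) : ℕ) = 3 ↔ ((ι q : Fin (N + 2)) : ℕ) = N := fun q => by
    rw [hwv]; constructor <;> intro h <;> split_ifs at * <;> omega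
  have hw2 : ∀ q, (((γ ∘ ι) q : Fin N) : ℕ) = 2 ↔ (((ι q : Fin (N + 2)) : ℕ) = 2 ∨ ((ι q : Fin (N + 2)) : ℕ) = N + 1) :=
    fun q => by rw [hwv]; constructor <;> intro h <;> split_ifs at * <;> omega
  have hx2 : ∀ q, (((φ ∘ ι) q : Fin N) : ℕ) = 2 ↔ ((ι q : Fin (N + 2)) : ℕ) = 2 := fun q => by
    show ((φ (ι q) : Fin N) : ℕ) = 2 ↔ _
    rw [hφv]; have := (ι q).2; constructor <;> intro h <;> split_ifs at * <;> omega
  -- letters only live in their columns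
  have hcol0 : ∀ q, 3 ≤ (((γ ∘ ι) q : Fin N) : ℕ) → (q : ℕ) < 4 := fun q hq => by
    by_contra h
    rcases lt_or_ge (q : ℕ) 10 with h' | h'
    · have := hlt12 q (by omega) h'; omega
    · have := harm q h'; omega
  have hcols : ∀ q, 1 ≤ (((γ ∘ ι) q : Fin N) : ℕ) → (q : ℕ) < 10 := fun q hq => by
    by_contra h; have := harm q (by omega); omega
  -- the letter-`ℓ` cell of each column
  have hcell0 : ∀ ℓ : Fin 4, (((γ ∘ ι) ⟨(π₀.symm ℓ : ℕ), by omega⟩ : Fin N) : ℕ) = (ℓ : ℕ) := fun ℓ => by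
    have h := hπ₀ (π₀.symm ℓ); rw [Equiv.apply_symm_apply] at h; exact h.symm
  have hcell1 : ∀ ℓ : Fin 3, (((γ ∘ ι) ⟨(π₁.symm ℓ : ℕ) + 4, by omega⟩ : Fin N) : ℕ) = (ℓ : ℕ) := fun ℓ => by
    have h := hπ₁ (π₁.symm ℓ); rw [Equiv.apply_symm_apply] at h; exact h.symm
  have hcell2 : ∀ ℓ : Fin 3, (((γ ∘ ι) ⟨(π₂.symm ℓ : ℕ) + 7, by omega⟩ : Fin N) : ℕ) = (ℓ : ℕ) := fun ℓ => by
    have h := hπ₂ (π₂.symm ℓ); rw [Equiv.apply_symm_apply] at h; exact h.symm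
  -- `N`: the letter-`3` cell of column `0`
  obtain ⟨pN, hpNv⟩ : ∃ p : Fin (N * 2), p = ⟨(π₀.symm 3 : ℕ), by omega⟩ := ⟨_, rfl⟩
  have hwpN : (((γ ∘ ι) pN : Fin N) : ℕ) = 3 := by rw [hpNv]; exact hcell0 3
  have hpN : ((ι pN : Fin (N + 2)) : ℕ) = N := (hw3 pN).1 hwpN
  have hNu : ∀ q, ((ι q : Fin (N + 2)) : ℕ) = N → q = pN := fun q hq => by
    have h3 := (hw3 q).2 hq
    exact hinj0 q pN (hcol0 q (by omega)) (by rw [hpNv]; exact (π₀.symm 3).2) (Fin.ext (by rw [h3, hwpN]))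
  -- the three letter-`2` cells
  obtain ⟨C0, hC0⟩ : ∃ p : Fin (N * 2), p = ⟨(π₀.symm 2 : ℕ), by omega⟩ := ⟨_, rfl⟩
  obtain ⟨C1, hC1⟩ : ∃ p : Fin (N * 2), p = ⟨(π₁.symm 2 : ℕ) + 4, by omega⟩ := ⟨_, rfl⟩
  obtain ⟨C2, hC2⟩ : ∃ p : Fin (N * 2), p = ⟨(π₂.symm 2 : ℕ) + 7, by omega⟩ := ⟨_, rfl⟩
  have hwC0 : (((γ ∘ ι) C0 : Fin N) : ℕ) = 2 := by rw [hC0]; exact hcell0 2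
  have hwC1 : (((γ ∘ ι) C1 : Fin N) : ℕ) = 2 := by rw [hC1]; exact hcell1 2
  have hwC2 : (((γ ∘ ι) C2 : Fin N) : ℕ) = 2 := by rw [hC2]; exact hcell2 2
  have hC0v : (C0 : ℕ) < 4 := by rw [hC0]; exact (π₀.symm 2).2
  have hC1v : 4 ≤ (C1 : ℕ) ∧ (C1 : ℕ) < 7 := by rw [hC1]; have := (π₁.symm 2).2; dsimp only; omega
  have hC2v : 7 ≤ (C2 : ℕ) ∧ (C2 : ℕ) < 10 := by rw [hC2]; have := (π₂.symm 2).2; dsimp only; omega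
  have hCmem : ∀ q, (((γ ∘ ι) q : Fin N) : ℕ) = 2 → q = C0 ∨ q = C1 ∨ q = C2 := fun q hq => by
    have hq10 := hcols q (by omega)
    rcases lt_or_ge (q : ℕ) 4 with h4 | h4
    · exact Or.inl (hinj0 q C0 h4 hC0v (Fin.ext (by rw [hq, hwC0])))
    rcases lt_or_ge (q : ℕ) 7 with h7 | h7
    · exact Or.inr (Or.inl (hinj1 q C1 h4 h7 hC1v.1 hC1v.2 (Fin.ext (by rw [hq, hwC1]))))
    · exact Or.inr (Or.inr (hinj2 q C2 h7 hq10 hC2v.1 hC2v.2 (Fin.ext (by rw [hq, hwC2]))))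
  have h01 : C0 ≠ C1 := Fin.ne_of_val_ne (by omega)
  have h02 : C0 ≠ C2 := Fin.ne_of_val_ne (by omega)
  have h12 : C1 ≠ C2 := Fin.ne_of_val_ne (by omega)
  -- equal first-leg values at distinct positions lie in different blocks
  have hxsep : ∀ q q', q ≠ q' → (φ ∘ ι) q = (φ ∘ ι) q' → (e q).1 ≠ (e q').1 := fun q q' hne hval hblk =>
    hne (eq_of_wordBlockSign_ne_zero e hx hblk hval)
  have hfin2 : ∀ a b c : Fin 2, a = b ∨ a = c ∨ b = c := by decide
  -- existence of `M`: not all three letter-`2` cells carry `ι = 2`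
  have hexM : ∃ pM, (((γ ∘ ι) pM : Fin N) : ℕ) = 2 ∧ ((ι pM : Fin (N + 2)) : ℕ) = N + 1 := by
    by_contra hnone
    push Not at hnone
    have hxC : ∀ C, (((γ ∘ ι) C : Fin N) : ℕ) = 2 → (φ ∘ ι) C = ⟨2, by omega⟩ := fun C hC =>
      Fin.ext ((hx2 C).2 (((hw2 C).1 hC).resolve_right (hnone C hC)))
    rcases hfin2 (e C0).1 (e C1).1 (e C2).1 with h | h | h
    · exact hxsep C0 C1 h01 ((hxC C0 hwC0).trans (hxC C1 hwC1).symm) h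
    · exact hxsep C0 C2 h02 ((hxC C0 hwC0).trans (hxC C2 hwC2).symm) h
    · exact hxsep C1 C2 h12 ((hxC C1 hwC1).trans (hxC C2 hwC2).symm) h
  obtain ⟨pM, hwpM, hpM⟩ := hexM
  refine ⟨pN, pM, hpN, hNu, hpM, fun q hq => ?_⟩
  -- uniqueness of `M`: the two `ι = 2` cells (one per block) and `q, pM` would be four of the three letter-`2` cells
  by_contra hqM
  have hwq : (((γ ∘ ι) q : Fin N) : ℕ) = 2 := (hw2 q).2 (Or.inr hq)
  obtain ⟨j0, hj0⟩ := (bijective_of_wordBlockSign_ne_zero e hx 0).2 ⟨2, by omega⟩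
  obtain ⟨j1, hj1⟩ := (bijective_of_wordBlockSign_ne_zero e hx 1).2 ⟨2, by omega⟩
  have hι0 : ((ι (e.symm (0, j0)) : Fin (N + 2)) : ℕ) = 2 := (hx2 _).1 (by rw [show (φ ∘ ι) (e.symm (0, j0)) = _ from hj0])
  have hι1 : ((ι (e.symm (1, j1)) : Fin (N + 2)) : ℕ) = 2 := (hx2 _).1 (by rw [show (φ ∘ ι) (e.symm (1, j1)) = _ from hj1])
  have hw0 : (((γ ∘ ι) (e.symm (0, j0)) : Fin N) : ℕ) = 2 := (hw2 _).2 (Or.inl hι0)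
  have hw1 : (((γ ∘ ι) (e.symm (1, j1)) : Fin N) : ℕ) = 2 := (hw2 _).2 (Or.inl hι1)
  have hP01 : e.symm (0, j0) ≠ e.symm (1, j1) := fun h => by
    have := congrArg (fun p => (e p).1) h; simp at this
  exact four_mem_three (hCmem q hwq) (hCmem pM hwpM) (hCmem _ hw0) (hCmem _ hw1) hqM
    (fun h => by rw [h] at hq; omega) (fun h => by rw [h] at hq; omega)
    (fun h => by rw [h] at hpM; omega) (fun h => by rw [h] at hpM; omega) hP01

/-! ### §3 The toggle identity -/

/-- **Toggle identity.**  For a well-formed `ι` (letters `N`, `N+1` exactly at `p_N`, `p_M`) whose special cells lie in one block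
of `e` and whose `κ`-images lie in one block of `e` (`κ` an involution), `ζ_e(φ∘ι) · ζ_e((ψ∘ι)∘κ) = ζ_e((φ∘ι)∘κ) · ζ_e(ψ∘ι)`:
indeed `ψ∘ι = (φ∘ι)∘(p_N p_M)` flips the sign of `ζ_e`, and so does `(ψ∘ι)∘κ = ((φ∘ι)∘κ)∘(κp_N κp_M)`. [this node] -/
theorem threeThreeOne_toggle_symm {N : ℕ} (e : Fin (N * 2) ≃ Fin 2 × Fin N) (κ : Equiv.Perm (Fin (N * 2)))
    (hκκ : ∀ q, κ (κ q) = q) {φ ψ : Fin (N + 2) → Fin N}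
    (hφv : ∀ r, ((φ r : Fin N) : ℕ) = if (r : ℕ) < N then (r : ℕ) else (r : ℕ) - N)
    (hψv : ∀ r, ((ψ r : Fin N) : ℕ) = if (r : ℕ) < N then (r : ℕ) else N + 1 - (r : ℕ))
    (ι : Fin (N * 2) → Fin (N + 2)) {pN pM : Fin (N * 2)}
    (hpN : ((ι pN : Fin (N + 2)) : ℕ) = N) (hNu : ∀ q, ((ι q : Fin (N + 2)) : ℕ) = N → q = pN)
    (hpM : ((ι pM : Fin (N + 2)) : ℕ) = N + 1) (hMu : ∀ q, ((ι q : Fin (N + 2)) : ℕ) = N + 1 → q = pM)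
    (htog : (e pN).1 = (e pM).1 ∧ (e (κ pN)).1 = (e (κ pM)).1) :
    wordBlockSign ℂ e (φ ∘ ι) * wordBlockSign ℂ e ((ψ ∘ ι) ∘ ⇑κ) =
      wordBlockSign ℂ e ((φ ∘ ι) ∘ ⇑κ) * wordBlockSign ℂ e (ψ ∘ ι) := by
  have hNM : pN ≠ pM := fun h => by rw [h, hpM] at hpN; omega
  have hrest : ∀ q, q ≠ pN → q ≠ pM → ((ι q : Fin (N + 2)) : ℕ) < N := fun q hqN hqM => by
    have := (ι q).2
    by_contra h
    rcases Nat.lt_or_ge ((ι q : Fin (N + 2)) : ℕ) (N + 1) with h' | h'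
    · exact hqN (hNu q (by omega))
    · exact hqM (hMu q (by omega))
  have hy : ψ ∘ ι = (φ ∘ ι) ∘ ⇑(Equiv.swap pN pM) := liftPair_second_eq hφv hψv hpN hpM hrest
  have hκNM : κ pN ≠ κ pM := fun h => hNM (κ.injective h)
  rw [hy, comp_swap_comp_of_apply_apply hκκ, wordBlockSign_comp_swap ℂ e hκNM htog.2,
    wordBlockSign_comp_swap ℂ e hNM htog.1]
  ring

end Summit.MatrixMultiplication.MatrixMultiplication.Theorems.ObstructionCalculus

end
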